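import Summits.CriticalPhenomena.PercolationContinuityZ3.Theorems.PercNearOneGluingNoHeavyLowerTailSahiCombTriWOrProduct

/-!
# The CONE THEOREM: `x_G ∧ Q` (all of an apex block, and a shell family `Q` on the other block) satisfies `TriWIneq`

Support file of the one-cut programme (crux `NoHeavyLowerTail`, stmt-CriticalPhenomena-4575; unit `prim-lf-1` gen 41, memo
`FROM-prim-lf-1-gen41-SHELLS-AND-OR-PRODUCTS.md` §5).  Companion of the OR-product theorem (`…SahiCombTriWOrProduct`): there the Formula-A stratum
(families whose shell `Q ∪ refl Q` is a Kleitman shell, `…TriWKlShell`) was shown closed under `∨` over disjoint blocks; here we treat the simplest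
`∧`: the CONE `andTop Q = {t | t.toLeft = univ ∧ t.toRight ∈ Q} ⊆ Finset (γ₁ ⊕ γ₂)` ("every coordinate of the apex block `γ₁`, and `Q` on `γ₂`").
Cones over shells are NOT shell families in general (`x₀(x₁ ∨ x₂)`, the stars `x₀(x₁ ∨ ⋯ ∨ x_k)`, `x₀·maj` are the classical 'flow' classes of P5's
census, with no 0/1 antipodal certificate), but they have an explicit score certificate: **Formula A of `Q` evaluated on the TOP sections**
`A_⊤ = {y | univ ⊔ y ∈ A}`, `B_⊤`:  `k(A,B) = #(S_Q ∩ B_⊤ ∩ refl A_⊤) + #(E_Q ∩ A_⊤ ∩ B_⊤)`  (`S_Q = Q ∩ refl Q`, `E_Q = Q \ refl Q`; `FiveUpSet.coneScore`).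

* `uForm_andTop`, `lForm_andTop` — the two sandwich forms of the cone in terms of the top and bottom sections `A_⊤ ⊇ A_⊥`:
  `U = 2#(Q∩A_⊤∩B_⊤) − #(refl Q∩A_⊥∩B_⊥)`, `L = #(Q∩refl A_⊥∩B_⊤) + #(Q∩A_⊤∩refl B_⊥) − #(refl Q∩A_⊥∩B_⊥)`;
* **`cone_identity`** — `k(A,B) − L(A,B) = klL (Q ∪ refl Q) (A_⊥ ∪ (A_⊤ ∩ E_Q)) (B_⊥ ∪ (B_⊤ ∩ E_Q)) + #(S_Q ∩ (B_⊤ \ B_⊥) ∩ refl (A_⊤ \ A_⊥))`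
  (an identity for EVERY `Q`; `E_Q` is an up-set, so the two arguments of `klL` are up-sets);
* **`scoreCert_coneScore`**, **`triW_nonneg_andTop`** — if `Q` is an up-set with a Kleitman shell then the cone satisfies `0 ≤ triW (andTop Q) F G` for EVERY
  index cube and all monotone families of up-sets (all `a`).  With `klShell_of_saturated / klShell_upGen / klShell_orProd / klShell_genUp_disjoint` this covers
  `x_G ∧ (x₁ ∨ ⋯ ∨ x_k)`, `x_G ∧ maj`, `x_G ∧ (x₁ ∨ x₂x₃)`, `x_G ∧ (↑h₁ ∪ ↑h₂)` (disjoint), `x_G ∧ (maj ∨ maj)`, … for every apex block `G`.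
Exact numerical cross-check (all pairs of up-sets, P5 oracle): every cone over a shell family on ≤ 4 coordinates (n ≤ 5), and at n = 6 the cones over
`x₁x₂ ∨ x₃x₄x₅`, `x₁ ∨ (≥3 of 2345)`, `maj(123) ∨ x₄x₅`, `x₁ ∨ x₂ ∨ x₃x₄x₅`, `↑12∪↑13∪↑23∪↑14`.
HONEST LABEL: complete proofs, std axioms; a new structural stratum theorem; `TriWIneq` itself stays OPEN (e.g. `K₂₂ = OR ∧ OR`, `K₃₃` are ∧-products of
two non-trivial blocks, not cones). [this work]
-/

namespace Summit.CriticalPhenomena.PercolationContinuityZ3.Theorems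

namespace FiveUpSet

open Finset

variable {β γ₁ γ₂ : Type} [DecidableEq β] [Fintype β] [DecidableEq γ₁] [Fintype γ₁] [DecidableEq γ₂] [Fintype γ₂]

/-! ### Rows of the product cube and the cone -/

/-- The row embedding `y ↦ x ⊔ y` of the second block at a fixed first coordinate `x`. [this work] -/
def rowEmb (x : Finset γ₁) : Finset γ₂ ↪ Finset (γ₁ ⊕ γ₂) :=
  ⟨fun y => x.disjSum y, fun y₁ y₂ h => by simpa using congrArg Finset.toRight h⟩

omit [DecidableEq β] [Fintype β] [DecidableEq γ₁] [Fintype γ₁] [DecidableEq γ₂] [Fintype γ₂] in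
/-- The row embedding applied. [this work] -/
@[simp] theorem rowEmb_apply (x : Finset γ₁) (y : Finset γ₂) : rowEmb x y = x.disjSum y := rfl

/-- The **cone** over `Q` with apex block `γ₁`: `{univ ⊔ y | y ∈ Q}`. [this work] -/
def andTop (Q : Finset (Finset γ₂)) : Finset (Finset (γ₁ ⊕ γ₂)) := Q.map (rowEmb (univ : Finset γ₁))

omit [DecidableEq β] [Fintype β] [DecidableEq γ₁] [DecidableEq γ₂] [Fintype γ₂] in
/-- Membership in the cone. [this work] -/
theorem mem_andTop {Q : Finset (Finset γ₂)} {t : Finset (γ₁ ⊕ γ₂)} : t ∈ andTop Q ↔ t.toLeft = univ ∧ t.toRight ∈ Q := by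
  unfold andTop
  rw [mem_map]
  constructor
  · rintro ⟨y, hy, rfl⟩
    simp [hy]
  · rintro ⟨h1, h2⟩
    exact ⟨t.toRight, h2, by rw [rowEmb_apply, eq_comm, eq_disjSum_iff]; exact ⟨h1, rfl⟩⟩

omit [DecidableEq β] [Fintype β] [DecidableEq γ₁] [DecidableEq γ₂] [Fintype γ₂] in
/-- The cone over an up-set is an up-set. [this work] -/
theorem isUpperSet_andTop {Q : Finset (Finset γ₂)} (hQ : IsUpperSet (Q : Set (Finset γ₂))) :
    IsUpperSet ((andTop Q : Finset (Finset (γ₁ ⊕ γ₂))) : Set (Finset (γ₁ ⊕ γ₂))) := by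
  intro t t' htt' ht
  rw [mem_coe, mem_andTop] at ht ⊢
  refine ⟨?_, hQ (toRight_subset_toRight htt') ht.2⟩
  exact eq_univ_of_forall fun a => toLeft_subset_toLeft htt' (ht.1 ▸ mem_univ a)

omit [DecidableEq β] [Fintype β] in
/-- The antipodal image of the cone is the bottom row over `refl Q`. [this work] -/
theorem refl_andTop (Q : Finset (Finset γ₂)) : refl (andTop Q) = (refl Q).map (rowEmb (∅ : Finset γ₁)) := by
  ext s
  rw [mem_refl, mem_andTop, mem_map]
  constructor
  · rintro ⟨h1, h2⟩
    refine ⟨s.toRight, mem_refl.2 (by rwa [toRight_compl] at h2), ?_⟩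
    rw [rowEmb_apply, eq_comm, eq_disjSum_iff]
    refine ⟨?_, rfl⟩
    rw [toLeft_compl] at h1
    have := congrArg compl h1
    rwa [compl_compl, compl_univ] at this
  · rintro ⟨y, hy, rfl⟩
    rw [rowEmb_apply, compl_disjSum, toLeft_disjSum, toRight_disjSum, compl_empty]
    exact ⟨rfl, mem_refl.1 hy⟩

omit [DecidableEq β] [Fintype β] [Fintype γ₁] in
/-- Counting points of a row inside two families = counting in the section. [this work] -/
theorem card_map_rowEmb_inter_inter (x : Finset γ₁) (R : Finset (Finset γ₂)) (A B : Finset (Finset (γ₁ ⊕ γ₂))) :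
    ((R.map (rowEmb x)) ∩ A ∩ B).card = (R ∩ secR A x ∩ secR B x).card := by
  have h : (R.map (rowEmb x)) ∩ A ∩ B = (R ∩ secR A x ∩ secR B x).map (rowEmb x) := by
    ext t
    simp only [mem_inter, mem_map, rowEmb_apply, mem_secR]
    constructor
    · rintro ⟨⟨⟨y, hy, rfl⟩, hA⟩, hB⟩
      exact ⟨y, ⟨⟨hy, hA⟩, hB⟩, rfl⟩
    · rintro ⟨y, ⟨⟨hy, hA⟩, hB⟩, rfl⟩
      exact ⟨⟨⟨y, hy, rfl⟩, hA⟩, hB⟩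
  rw [h, card_map]

omit [DecidableEq β] [Fintype β] in
/-- Sections of the antipodal image: `(refl A)_x = refl (A_{xᶜ})`. [this work] -/
theorem secR_refl (A : Finset (Finset (γ₁ ⊕ γ₂))) (x : Finset γ₁) : secR (refl A) x = refl (secR A xᶜ) := by
  ext y
  rw [mem_secR, mem_refl, mem_refl, mem_secR, compl_disjSum]

/-! ### The two forms of the cone -/

omit [DecidableEq β] [Fintype β] in
/-- **Upper form of the cone**: `U(A,B) = 2#(Q ∩ A_⊤ ∩ B_⊤) − #(refl Q ∩ A_⊥ ∩ B_⊥)`. [this work] -/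
theorem uForm_andTop (Q : Finset (Finset γ₂)) (A B : Finset (Finset (γ₁ ⊕ γ₂))) :
    uForm (andTop Q) A B = 2 * ((Q ∩ secR A univ ∩ secR B univ).card : ℤ) - (refl Q ∩ secR A ∅ ∩ secR B ∅).card := by
  unfold uForm
  rw [andTop, card_map_rowEmb_inter_inter, ← andTop, refl_andTop, card_map_rowEmb_inter_inter]

omit [DecidableEq β] [Fintype β] in
/-- **Lower form of the cone**: `L(A,B) = #(Q ∩ refl A_⊥ ∩ B_⊤) + #(Q ∩ A_⊤ ∩ refl B_⊥) − #(refl Q ∩ A_⊥ ∩ B_⊥)`. [this work] -/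
theorem lForm_andTop (Q : Finset (Finset γ₂)) (A B : Finset (Finset (γ₁ ⊕ γ₂))) :
    lForm (andTop Q) A B = ((Q ∩ refl (secR A ∅) ∩ secR B univ).card : ℤ) + (Q ∩ secR A univ ∩ refl (secR B ∅)).card
      - (refl Q ∩ secR A ∅ ∩ secR B ∅).card := by
  unfold lForm
  rw [andTop, card_map_rowEmb_inter_inter, card_map_rowEmb_inter_inter, ← andTop, refl_andTop, card_map_rowEmb_inter_inter,
    secR_refl, secR_refl, compl_univ]

/-! ### The cone score: Formula A of `Q` on the top sections -/

/-- The cone score: on a top-row point `univ ⊔ y`, `y ∈ Q`: `[univ ⊔ yᶜ ∈ A]` if `yᶜ ∈ Q` (antidiagonal unit), else `[univ ⊔ y ∈ A]` (diagonal unit). [this work] -/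
def coneScore (Q : Finset (Finset γ₂)) (A : Finset (Finset (γ₁ ⊕ γ₂))) (t : Finset (γ₁ ⊕ γ₂)) : ℕ :=
  if t.toLeft = univ ∧ t.toRight ∈ Q then
    (if t.toRightᶜ ∈ Q then (if (univ : Finset γ₁).disjSum t.toRightᶜ ∈ A then 1 else 0) else (if t ∈ A then 1 else 0))
  else 0

omit [DecidableEq β] [Fintype β] in
/-- The cone score is monotone in the family. [this work] -/
theorem monoScore_coneScore (Q : Finset (Finset γ₂)) : MonoScore (coneScore (γ₁ := γ₁) Q) := by
  intro A A' hAA' t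
  unfold coneScore
  by_cases h1 : t.toLeft = univ ∧ t.toRight ∈ Q
  · rw [if_pos h1, if_pos h1]
    by_cases h2 : t.toRightᶜ ∈ Q
    · rw [if_pos h2, if_pos h2]
      by_cases h3 : (univ : Finset γ₁).disjSum t.toRightᶜ ∈ A
      · rw [if_pos h3, if_pos (hAA' h3)]
      · rw [if_neg h3]; exact Nat.zero_le _
    · rw [if_neg h2, if_neg h2]
      by_cases h3 : t ∈ A
      · rw [if_pos h3, if_pos (hAA' h3)]
      · rw [if_neg h3]; exact Nat.zero_le _
  · rw [if_neg h1, if_neg h1]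

omit [DecidableEq β] [Fintype β] in
/-- **Value of the cone score**: `Σ_{t∈B} coneScore Q A t = #(Q ∩ refl Q ∩ B_⊤ ∩ refl A_⊤) + #((Q \ refl Q) ∩ A_⊤ ∩ B_⊤)`. [this work] -/
theorem scoreVal_coneScore (Q : Finset (Finset γ₂)) (A B : Finset (Finset (γ₁ ⊕ γ₂))) :
    scoreVal (coneScore Q) A B
      = ((Q ∩ refl Q ∩ secR B univ ∩ refl (secR A univ)).card : ℤ) + ((Q \ refl Q) ∩ secR A univ ∩ secR B univ).card := by
  unfold scoreVal
  -- only top-row points of `Q` contribute; pass to the section `B_⊤`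
  have hzero : ∀ t ∈ B, t ∉ (Q.map (rowEmb (univ : Finset γ₁))) → (coneScore Q A t : ℤ) = 0 := by
    intro t _ ht
    unfold coneScore
    rw [if_neg]
    · simp
    · intro h
      exact ht (mem_andTop.2 h)
  rw [← Finset.sum_subset (inter_subset_left (s₁ := B) (s₂ := Q.map (rowEmb (univ : Finset γ₁))))
    (fun t htB htn => hzero t htB (fun htR => htn (mem_inter.2 ⟨htB, htR⟩)))]
  -- the sum over `B ∩ row(Q)` as a sum over `y ∈ Q ∩ B_⊤`
  have hre : ∑ t ∈ B ∩ Q.map (rowEmb (univ : Finset γ₁)), (coneScore Q A t : ℤ)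
      = ∑ y ∈ Q ∩ secR B univ, (coneScore Q A ((univ : Finset γ₁).disjSum y) : ℤ) := by
    rw [show B ∩ Q.map (rowEmb (univ : Finset γ₁)) = (Q ∩ secR B univ).map (rowEmb univ) by
      ext t
      simp only [mem_inter, mem_map, rowEmb_apply, mem_secR]
      constructor
      · rintro ⟨hB, y, hy, rfl⟩; exact ⟨y, ⟨hy, hB⟩, rfl⟩
      · rintro ⟨y, ⟨hy, hB⟩, rfl⟩; exact ⟨hB, y, hy, rfl⟩]
    rw [sum_map]
    rfl
  rw [hre]
  -- evaluate the score on a top-row point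
  have hval : ∀ y ∈ Q ∩ secR B univ, (coneScore Q A ((univ : Finset γ₁).disjSum y) : ℤ)
      = (if y ∈ Q ∩ refl Q ∩ secR B univ ∩ refl (secR A univ) then 1 else 0)
        + (if y ∈ (Q \ refl Q) ∩ secR A univ ∩ secR B univ then 1 else 0) := by
    intro y hy
    rw [mem_inter] at hy
    unfold coneScore
    rw [toLeft_disjSum, toRight_disjSum, if_pos ⟨rfl, hy.1⟩]
    by_cases hc : yᶜ ∈ Q
    · rw [if_pos hc]
      have h2 : y ∉ (Q \ refl Q) ∩ secR A univ ∩ secR B univ := by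
        intro h; simp only [mem_inter, mem_sdiff, mem_refl] at h; exact h.1.1.2 hc
      rw [if_neg h2, add_zero]
      by_cases h3 : (univ : Finset γ₁).disjSum yᶜ ∈ A
      · rw [if_pos h3, if_pos]; · simp
        simp only [mem_inter, mem_refl, mem_secR]; exact ⟨⟨⟨hy.1, hc⟩, mem_secR.1 hy.2⟩, h3⟩
      · rw [if_neg h3, if_neg]; · simp
        simp only [mem_inter, mem_refl, mem_secR]; intro h; exact h3 h.2
    · rw [if_neg hc]
      have h2 : y ∉ Q ∩ refl Q ∩ secR B univ ∩ refl (secR A univ) := by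
        intro h; simp only [mem_inter, mem_refl] at h; exact hc h.1.1.2
      rw [if_neg h2, zero_add]
      by_cases h3 : (univ : Finset γ₁).disjSum y ∈ A
      · rw [if_pos h3, if_pos]; · simp
        simp only [mem_inter, mem_sdiff, mem_refl, mem_secR]; exact ⟨⟨⟨hy.1, hc⟩, h3⟩, mem_secR.1 hy.2⟩
      · rw [if_neg h3, if_neg]; · simp
        simp only [mem_inter, mem_sdiff, mem_refl, mem_secR]; intro h; exact h3 h.1.2
  rw [Finset.sum_congr rfl hval, sum_add_distrib, Finset.sum_boole, Finset.sum_boole]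
  congr 1
  · congr 2
    ext y; simp only [mem_filter, mem_inter, mem_refl, mem_secR]; tauto
  · congr 2
    ext y; simp only [mem_filter, mem_inter, mem_refl, mem_secR, mem_sdiff]; tauto

/-! ### The cone identity -/

omit [DecidableEq β] [Fintype β] [DecidableEq γ₁] [Fintype γ₁] in
/-- Cardinality of a triple intersection as an indicator sum over the whole cube. [this work] -/
theorem card_inter₃_eq_sum (X Y Z : Finset (Finset γ₂)) :
    ((X ∩ Y ∩ Z).card : ℤ) = ∑ y : Finset γ₂, ind X y * ind Y y * ind Z y := by
  rw [show X ∩ Y ∩ Z = (X ∩ Y ∩ Z) ∩ univ by rw [inter_univ], card_inter_eq_sum_ind]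
  refine sum_congr rfl fun y _ => ?_
  unfold ind
  by_cases hX : y ∈ X <;> by_cases hY : y ∈ Y <;> by_cases hZ : y ∈ Z <;> simp [hX, hY, hZ, mem_inter]

omit [DecidableEq β] [Fintype β] [DecidableEq γ₁] [Fintype γ₁] in
/-- A sum over the cube is determined by its symmetrisation along the antipode. [this work] -/
theorem sum_eq_sum_of_add_compl_eq {f g : Finset γ₂ → ℤ} (h : ∀ y : Finset γ₂, f y + f yᶜ = g y + g yᶜ) :
    ∑ y : Finset γ₂, f y = ∑ y : Finset γ₂, g y := by
  have hf : ∑ y : Finset γ₂, f yᶜ = ∑ y : Finset γ₂, f y :=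
    Fintype.sum_equiv (complEquiv γ₂) _ _ fun y => rfl
  have hg : ∑ y : Finset γ₂, g yᶜ = ∑ y : Finset γ₂, g y :=
    Fintype.sum_equiv (complEquiv γ₂) _ _ fun y => rfl
  have h2 : ∑ y : Finset γ₂, f y + ∑ y : Finset γ₂, f yᶜ = ∑ y : Finset γ₂, g y + ∑ y : Finset γ₂, g yᶜ := by
    rw [← sum_add_distrib, ← sum_add_distrib]
    exact sum_congr rfl fun y _ => h y
  rw [hf, hg] at h2
  linarith

omit [DecidableEq β] [Fintype β] [DecidableEq γ₁] [Fintype γ₁] [Fintype γ₂] in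
/-- Indicator of an intersection. [this work] -/
theorem ind_inter (X Y : Finset (Finset γ₂)) (y : Finset γ₂) : ind (X ∩ Y) y = ind X y * ind Y y := by
  unfold ind; by_cases hX : y ∈ X <;> by_cases hY : y ∈ Y <;> simp [hX, hY, mem_inter]

omit [DecidableEq β] [Fintype β] [DecidableEq γ₁] [Fintype γ₁] [Fintype γ₂] in
/-- Indicator of a union. [this work] -/
theorem ind_union (X Y : Finset (Finset γ₂)) (y : Finset γ₂) : ind (X ∪ Y) y = ind X y + ind Y y - ind X y * ind Y y := by
  unfold ind; by_cases hX : y ∈ X <;> by_cases hY : y ∈ Y <;> simp [hX, hY, mem_union]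

omit [DecidableEq β] [Fintype β] [DecidableEq γ₁] [Fintype γ₁] [Fintype γ₂] in
/-- Indicator of a difference. [this work] -/
theorem ind_sdiff (X Y : Finset (Finset γ₂)) (y : Finset γ₂) : ind (X \ Y) y = ind X y * (1 - ind Y y) := by
  unfold ind; by_cases hX : y ∈ X <;> by_cases hY : y ∈ Y <;> simp [hX, hY, mem_sdiff]

omit [DecidableEq β] [Fintype β] [DecidableEq γ₁] [Fintype γ₁] in
/-- Indicator of the antipodal image. [this work] -/
theorem ind_refl (X : Finset (Finset γ₂)) (y : Finset γ₂) : ind (refl X) y = ind X yᶜ := by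
  unfold ind; simp only [mem_refl]

omit [DecidableEq β] [Fintype β] [DecidableEq γ₁] [Fintype γ₁] [Fintype γ₂] in
/-- Indicators take the values `0, 1`. [this work] -/
theorem ind_cases (X : Finset (Finset γ₂)) (y : Finset γ₂) : ind X y = 0 ∨ ind X y = 1 := by
  unfold ind; by_cases h : y ∈ X <;> simp [h]

omit [DecidableEq β] [Fintype β] [DecidableEq γ₁] [Fintype γ₁] [Fintype γ₂] in
/-- Indicators are monotone in the set. [this work] -/
theorem ind_le_of_subset {X Y : Finset (Finset γ₂)} (h : X ⊆ Y) (y : Finset γ₂) : ind X y ≤ ind Y y := by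
  unfold ind; by_cases hX : y ∈ X
  · simp [hX, h hX]
  · by_cases hY : y ∈ Y <;> simp [hX, hY]

omit [DecidableEq β] [Fintype β] [DecidableEq γ₁] [Fintype γ₁] in
/-- A sum over a sub-family as an indicator-weighted sum over the cube. [this work] -/
theorem sum_mem_eq_sum_ind (X : Finset (Finset γ₂)) (h : Finset γ₂ → ℤ) : ∑ y ∈ X, h y = ∑ y : Finset γ₂, ind X y * h y := by
  unfold ind
  rw [← Finset.sum_filter_add_sum_filter_not univ (fun y => y ∈ X)]
  rw [Finset.sum_eq_zero (s := univ.filter fun y => ¬ y ∈ X) (fun y hy => by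
    rw [mem_filter] at hy; simp [hy.2]), add_zero, filter_mem_eq_inter, univ_inter]
  exact sum_congr rfl fun y hy => by simp [hy]

omit [DecidableEq β] [Fintype β] [DecidableEq γ₁] [Fintype γ₁] in
/-- Cardinality of a fourfold intersection as an indicator sum. [this work] -/
theorem card_inter₄_eq_sum (X Y Z V : Finset (Finset γ₂)) :
    ((X ∩ Y ∩ Z ∩ V).card : ℤ) = ∑ y : Finset γ₂, ind X y * ind Y y * ind Z y * ind V y := by
  rw [card_inter₃_eq_sum]
  exact sum_congr rfl fun y _ => by rw [ind_inter]

/-- The arithmetic core of the cone identity (one antipodal pair `{y, yᶜ}`; `q, q'` = membership of `y, yᶜ` in `Q`; `a0 ≤ a1`, `a0' ≤ a1'` = the bottom/top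
sections of `A` at `y, yᶜ`; `b`'s likewise): `f(y) + f(yᶜ) = g(y) + g(yᶜ)` for the integrands of `score − L` and of `klL + extra`. [this work] -/
theorem cone_pair_int (q q' a0 a1 a0' a1' b0 b1 b0' b1' : ℤ)
    (hq : q = 0 ∨ q = 1) (hq' : q' = 0 ∨ q' = 1) (ha0 : a0 = 0 ∨ a0 = 1) (ha1 : a1 = 0 ∨ a1 = 1) (ha0' : a0' = 0 ∨ a0' = 1)
    (ha1' : a1' = 0 ∨ a1' = 1) (hb0 : b0 = 0 ∨ b0 = 1) (hb1 : b1 = 0 ∨ b1 = 1) (hb0' : b0' = 0 ∨ b0' = 1) (hb1' : b1' = 0 ∨ b1' = 1)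
    (ha : a0 ≤ a1) (ha' : a0' ≤ a1') (hb : b0 ≤ b1) (hb' : b0' ≤ b1') :
    (q * q' * b1 * a1' + q * (1 - q') * a1 * b1 - (q * a0' * b1 + q * a1 * b0' - q' * a0 * b0))
      + (q' * q * b1' * a1 + q' * (1 - q) * a1' * b1' - (q' * a0 * b1' + q' * a1' * b0 - q * a0' * b0'))
    = ((q + q' - q * q') * (((a0 + a1 * (q * (1 - q')) - a0 * (a1 * (q * (1 - q'))))
          - (a0' + a1' * (q' * (1 - q)) - a0' * (a1' * (q' * (1 - q))))) * (b0 + b1 * (q * (1 - q')) - b0 * (b1 * (q * (1 - q')))))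
        + q * q' * (b1 * (1 - b0)) * (a1' * (1 - a0')))
      + ((q' + q - q' * q) * (((a0' + a1' * (q' * (1 - q)) - a0' * (a1' * (q' * (1 - q))))
          - (a0 + a1 * (q * (1 - q')) - a0 * (a1 * (q * (1 - q'))))) * (b0' + b1' * (q' * (1 - q)) - b0' * (b1' * (q' * (1 - q)))))
        + q' * q * (b1' * (1 - b0')) * (a1 * (1 - a0))) := by
  rcases hq with rfl | rfl <;> rcases hq' with rfl | rfl <;> rcases ha0 with rfl | rfl <;> rcases ha1 with rfl | rfl <;>
    rcases ha0' with rfl | rfl <;> rcases ha1' with rfl | rfl <;> rcases hb0 with rfl | rfl <;> rcases hb1 with rfl | rfl <;>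
    rcases hb0' with rfl | rfl <;> rcases hb1' with rfl | rfl <;> omega

omit [DecidableEq β] [Fintype β] [DecidableEq γ₁] [Fintype γ₁] in
/-- **The cone identity on the base cube.**  For families `A0 ⊆ A1`, `B0 ⊆ B1` of `Finset γ₂`, with `E = Q \ refl Q`, `S = Q ∩ refl Q`, `T = Q ∪ refl Q`:
`[#(S∩B1∩refl A1) + #(E∩A1∩B1)] − [#(Q∩refl A0∩B1) + #(Q∩A1∩refl B0) − #(refl Q∩A0∩B0)]`
`= klL T (A0 ∪ (A1 ∩ E)) (B0 ∪ (B1 ∩ E)) + #(S ∩ (B1 \ B0) ∩ refl (A1 \ A0))`. [this work] -/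
theorem cone_identity_base (Q A0 A1 B0 B1 : Finset (Finset γ₂)) (hA : A0 ⊆ A1) (hB : B0 ⊆ B1) :
    (((Q ∩ refl Q ∩ B1 ∩ refl A1).card : ℤ) + ((Q \ refl Q) ∩ A1 ∩ B1).card)
      - (((Q ∩ refl A0 ∩ B1).card : ℤ) + (Q ∩ A1 ∩ refl B0).card - (refl Q ∩ A0 ∩ B0).card)
      = klL (Q ∪ refl Q) (A0 ∪ (A1 ∩ (Q \ refl Q))) (B0 ∪ (B1 ∩ (Q \ refl Q)))
        + ((Q ∩ refl Q ∩ (B1 \ B0) ∩ refl (A1 \ A0)).card : ℤ) := by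
  have hF : (((Q ∩ refl Q ∩ B1 ∩ refl A1).card : ℤ) + ((Q \ refl Q) ∩ A1 ∩ B1).card)
      - (((Q ∩ refl A0 ∩ B1).card : ℤ) + (Q ∩ A1 ∩ refl B0).card - (refl Q ∩ A0 ∩ B0).card)
      = ∑ y : Finset γ₂, (ind Q y * ind (refl Q) y * ind B1 y * ind (refl A1) y + ind (Q \ refl Q) y * ind A1 y * ind B1 y
          - (ind Q y * ind (refl A0) y * ind B1 y + ind Q y * ind A1 y * ind (refl B0) y - ind (refl Q) y * ind A0 y * ind B0 y)) := by
    simp only [sum_add_distrib, sum_sub_distrib, ← card_inter₃_eq_sum, ← card_inter₄_eq_sum]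
  have hG : klL (Q ∪ refl Q) (A0 ∪ (A1 ∩ (Q \ refl Q))) (B0 ∪ (B1 ∩ (Q \ refl Q))) + ((Q ∩ refl Q ∩ (B1 \ B0) ∩ refl (A1 \ A0)).card : ℤ)
      = ∑ y : Finset γ₂, (ind (Q ∪ refl Q) y * ((ind (A0 ∪ (A1 ∩ (Q \ refl Q))) y - ind (refl (A0 ∪ (A1 ∩ (Q \ refl Q)))) y)
            * ind (B0 ∪ (B1 ∩ (Q \ refl Q))) y)
          + ind Q y * ind (refl Q) y * ind (B1 \ B0) y * ind (refl (A1 \ A0)) y) := by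
    rw [klL_eq_sum_ind, sum_mem_eq_sum_ind]
    simp only [sum_add_distrib, ← card_inter₄_eq_sum]
  rw [hF, hG]
  apply sum_eq_sum_of_add_compl_eq
  intro y
  simp only [ind_refl, ind_union, ind_inter, ind_sdiff, compl_compl]
  exact cone_pair_int _ _ _ _ _ _ _ _ _ _ (ind_cases Q y) (ind_cases Q yᶜ) (ind_cases A0 y) (ind_cases A1 y) (ind_cases A0 yᶜ)
    (ind_cases A1 yᶜ) (ind_cases B0 y) (ind_cases B1 y) (ind_cases B0 yᶜ) (ind_cases B1 yᶜ)
    (ind_le_of_subset hA y) (ind_le_of_subset hA yᶜ) (ind_le_of_subset hB y) (ind_le_of_subset hB yᶜ)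

omit [DecidableEq β] [Fintype β] in
/-- **The cone identity.**  With `A_⊥ = secR A ∅ ⊆ A_⊤ = secR A univ` (and likewise for `B`), `E = Q \ refl Q`, `S = Q ∩ refl Q`, `T = Q ∪ refl Q`:
`Σ_B coneScore − L_{andTop Q}(A,B) = klL T (A_⊥ ∪ (A_⊤ ∩ E)) (B_⊥ ∪ (B_⊤ ∩ E)) + #(S ∩ (B_⊤ \ B_⊥) ∩ refl (A_⊤ \ A_⊥))`. [this work] -/
theorem cone_identity (Q : Finset (Finset γ₂)) {A B : Finset (Finset (γ₁ ⊕ γ₂))}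
    (hA : secR A ∅ ⊆ secR A univ) (hB : secR B ∅ ⊆ secR B univ) :
    scoreVal (coneScore Q) A B - lForm (andTop Q) A B
      = klL (Q ∪ refl Q) (secR A ∅ ∪ (secR A univ ∩ (Q \ refl Q))) (secR B ∅ ∪ (secR B univ ∩ (Q \ refl Q)))
        + ((Q ∩ refl Q ∩ (secR B univ \ secR B ∅) ∩ refl (secR A univ \ secR A ∅)).card : ℤ) := by
  rw [scoreVal_coneScore, lForm_andTop]
  exact cone_identity_base Q _ _ _ _ hA hB

omit [DecidableEq β] [Fintype β] in
/-- Sections of an up-set are nested: `A_⊥ ⊆ A_⊤`. [this work] -/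
theorem secR_empty_subset_secR_univ {A : Finset (Finset (γ₁ ⊕ γ₂))} (hA : IsUpperSet (A : Set (Finset (γ₁ ⊕ γ₂)))) :
    secR A ∅ ⊆ secR A univ := by
  intro y hy
  rw [mem_secR] at hy ⊢
  exact hA (disjSum_mono (empty_subset _) le_rfl) hy

/-- **The cone score is a score certificate** for `andTop Q` whenever `Q` is an up-set whose shell is a Kleitman shell. [this work] -/
theorem scoreCert_coneScore {Q : Finset (Finset γ₂)} (hQ : IsUpperSet (Q : Set (Finset γ₂))) (hT : KlShell (Q ∪ refl Q)) :
    ScoreCert (andTop Q : Finset (Finset (γ₁ ⊕ γ₂))) (coneScore Q) := by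
  intro A B hA hB
  have hA01 := secR_empty_subset_secR_univ hA
  have hB01 := secR_empty_subset_secR_univ hB
  have hA1 : IsUpperSet (secR A univ : Set (Finset γ₂)) := isUpperSet_secR hA univ
  have hB1 : IsUpperSet (secR B univ : Set (Finset γ₂)) := isUpperSet_secR hB univ
  have hA0 : IsUpperSet (secR A ∅ : Set (Finset γ₂)) := isUpperSet_secR hA ∅
  have hB0 : IsUpperSet (secR B ∅ : Set (Finset γ₂)) := isUpperSet_secR hB ∅
  have hE : IsUpperSet ((Q \ refl Q : Finset (Finset γ₂)) : Set (Finset γ₂)) := by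
    rw [coe_sdiff]; exact hQ.sdiff_of_isLowerSet (isLowerSet_refl hQ)
  constructor
  · -- lower bound: the cone identity + the shell hypothesis
    have hid := cone_identity Q hA01 hB01
    have hX : IsUpperSet ((secR A ∅ ∪ (secR A univ ∩ (Q \ refl Q)) : Finset (Finset γ₂)) : Set (Finset γ₂)) := by
      rw [coe_union, coe_inter]; exact hA0.union (hA1.inter hE)
    have hY : IsUpperSet ((secR B ∅ ∪ (secR B univ ∩ (Q \ refl Q)) : Finset (Finset γ₂)) : Set (Finset γ₂)) := by
      rw [coe_union, coe_inter]; exact hB0.union (hB1.inter hE)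
    have h1 := hT _ _ hX hY
    have h2 : (0 : ℤ) ≤ ((Q ∩ refl Q ∩ (secR B univ \ secR B ∅) ∩ refl (secR A univ \ secR A ∅)).card : ℤ) := by positivity
    linarith
  · -- upper bound: Formula A of `Q` on the top sections (gen 39 `ptVal_kapA_le_uForm`) and `A_⊥ ∩ B_⊥ ⊆ A_⊤ ∩ B_⊤`
    rw [scoreVal_coneScore, uForm_andTop]
    have hk : ((Q ∩ refl Q ∩ secR B univ ∩ refl (secR A univ)).card : ℤ) + ((Q \ refl Q) ∩ secR A univ ∩ secR B univ).card
        = ptVal (kapA Q) (secR B univ) (secR A univ) := by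
      rw [ptVal_kapA, show (Q \ refl Q) ∩ secR A univ ∩ secR B univ = (Q \ refl Q) ∩ secR B univ ∩ secR A univ by
        ext y; simp only [mem_inter]; tauto]
    have hup := ptVal_kapA_le_uForm hQ hB1 hA1
    unfold uForm at hup
    have e1 : Q ∩ secR B univ ∩ secR A univ = Q ∩ secR A univ ∩ secR B univ := by ext y; simp only [mem_inter]; tauto
    have hsub : refl Q ∩ secR A ∅ ∩ secR B ∅ ⊆ refl Q ∩ secR B univ ∩ secR A univ := by
      intro y hy; simp only [mem_inter] at hy ⊢; exact ⟨⟨hy.1.1, hB01 hy.2⟩, hA01 hy.1.2⟩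
    have hc : ((refl Q ∩ secR A ∅ ∩ secR B ∅).card : ℤ) ≤ (refl Q ∩ secR B univ ∩ secR A univ).card := by
      exact_mod_cast card_le_card hsub
    rw [e1] at hup
    linarith

/-- **THE CONE THEOREM.**  If `Q` is an up-set of `Finset γ₂` whose shell `Q ∪ refl Q` is a Kleitman shell, then the cone `andTop Q ⊆ Finset (γ₁ ⊕ γ₂)`
(all of the apex block `γ₁`, and `Q`) satisfies `0 ≤ triW (andTop Q) F G` for EVERY index cube and all monotone families of up-sets. [this work] -/
theorem triW_nonneg_andTop {Q : Finset (Finset γ₂)} (hQ : IsUpperSet (Q : Set (Finset γ₂))) (hT : KlShell (Q ∪ refl Q))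
    (F G : Finset β → Finset (Finset (γ₁ ⊕ γ₂)))
    (hF : ∀ x, IsUpperSet (F x : Set (Finset (γ₁ ⊕ γ₂)))) (hG : ∀ x, IsUpperSet (G x : Set (Finset (γ₁ ⊕ γ₂))))
    (hFm : Monotone F) (hGm : Monotone G) :
    0 ≤ triW (andTop Q) F G :=
  triW_nonneg_of_scoreCert (monoScore_coneScore Q) (scoreCert_coneScore hQ hT) F G hF hG hFm hGm

end FiveUpSet

end Summit.CriticalPhenomena.PercolationContinuityZ3.Theorems
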